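import Mathlib
import HarnessLib

/-!
# Route `AdditiveBranchIMC`, cruxes `GordTwoRankZeroOffCaseOne` (stmt-19357) / `MultLower` (stmt-19359),
# stub U-a (`stub_genusGrossZagier[M]`) — part 5a: the GENUS SPLIT `d_{K″} = d₁ · d₂` of a
# fundamental discriminant along a prescribed set of odd primes (elementary genus theory)

Cell `bsd-addord`, seat `bsd-line-addord-w4` (stub-worker under the lead of crux 19357). HONEST
FRAMING: helper theorems only, pure arithmetic (no `def`, no named fact, nothing about BSD). The road
residue of stub U-a (`road_fourthCurve_gord` in the seat's notes) starts by splitting the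
discriminant `D = d_{K″}` of the `p`-ramified Kolyvagin field into two fundamental discriminants
`d₁ d₂ = D` with `p ∣ d₁`: `d₁` collects the prime discriminants `ℓ* = (−1)^{(ℓ−1)/2} ℓ` of the odd
primes `ℓ` in a prescribed set (on the road: `p` and the odd primes dividing both `N_{Wd}` and `D`),
`d₂` those of the other odd primes of `D`, and the dyadic part of `D` goes to a prescribed side
(Gauss's genus theory; Cox §3.B / Thm. 3.15: `D = ∏ pᵢ*` is the unique factorisation of a fundamental
discriminant into prime discriminants). Fundamental discriminants are spelled out as in
`QuadraticFields/FundamentalDiscriminant.lean` and Gross 2004's named fact: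
`(d % 4 = 1 ∧ Squarefree d ∧ d ≠ 1) ∨ (4 ∣ d ∧ (d/4 % 4 = 2 ∨ d/4 % 4 = 3) ∧ Squarefree (d/4))`.

* `exists_primeDiscr` — `ℓ* ∈ {ℓ, −ℓ}` with `ℓ* ≡ 1 (mod 4)` for an odd prime `ℓ`.
* `isFundamental_primeDiscr_mul` — `ℓ* · d` is a fundamental discriminant for `d` fundamental or `1`
  with `ℓ ∤ d`.
* `isFundamental_or_eq_one_div_primeDiscr` — peeling: for `D` fundamental and an odd prime `ℓ ∣ D`,
  `D/ℓ*` is fundamental or `1`, `D = ℓ* · (D/ℓ*)` and `ℓ ∤ D/ℓ*`.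
* `exists_genusSplit` — for `D` fundamental or `1` and any predicate `P` on primes: `D = d₁ d₂` with
  `d₁, d₂` fundamental or `1`, every odd prime `ℓ ∣ D` dividing `d₁` if `P ℓ` and `d₂` otherwise, and
  the dyadic part on the side of `P 2` (`d₂ ≡ 1 (mod 4)` if `P 2`, else `d₁ ≡ 1 (mod 4)`).

References: Cox, *Primes of the form x² + ny²*, §3.B (genus theory, prime discriminants); Gross
2004 §2 (factorisations `D = d₁ d₂`).
-/

set_option autoImplicit false

-- D-0017 layout: summit = sub-problem, so `Summit.BirchSwinnertonDyer.BirchSwinnertonDyer.…` is the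
-- mandated namespace (same option as the route's sockets files).
set_option linter.dupNamespace false

namespace Summit.BirchSwinnertonDyer.BirchSwinnertonDyer.Theorems.GenusGrossZagier

/-! ## §1 Prime discriminants -/

/-- **The prime discriminant `ℓ*` of an odd prime**: `ℓ* ∈ {ℓ, −ℓ}` with `ℓ* ≡ 1 (mod 4)`.
[cite: Cox2013, §3.B (prime discriminants)] -/
theorem exists_primeDiscr {ℓ : ℕ} (hℓ : ℓ.Prime) (h2 : ℓ ≠ 2) :
    ∃ e : ℤ, e % 4 = 1 ∧ (e = ℓ ∨ e = -ℓ) := by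
  have hodd : ℓ % 2 = 1 := Nat.odd_iff.mp (hℓ.odd_of_ne_two h2)
  by_cases h1 : ℓ % 4 = 1
  · exact ⟨ℓ, by omega, Or.inl rfl⟩
  · exact ⟨-ℓ, by omega, Or.inr rfl⟩

/-- `e ≡ 1 (mod 4)` does not change residues mod `4` by multiplication. [folklore] -/
theorem mul_emod_four_of_emod_four_eq_one {e : ℤ} (he : e % 4 = 1) (x : ℤ) :
    e * x % 4 = x % 4 := by
  rw [Int.mul_emod, he, one_mul, Int.emod_emod_of_dvd _ (dvd_refl 4)]

/-- A prime discriminant `ℓ* = ±ℓ` (odd prime `ℓ`) is coprime to any integer `ℓ` does not divide,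
and is squarefree and `≠ 1`. [folklore] -/
theorem primeDiscr_props {ℓ : ℕ} (hℓ : ℓ.Prime) (h2 : ℓ ≠ 2) {e : ℤ} (he : e = ℓ ∨ e = -ℓ) :
    Squarefree e ∧ e ≠ 1 ∧ e ≠ 0 ∧ (ℓ : ℤ) ∣ e ∧
      ∀ d : ℤ, ¬ (ℓ : ℤ) ∣ d → IsCoprime e d := by
  have hℓZ : Prime (ℓ : ℤ) := Nat.prime_iff_prime_int.mp hℓ
  have hirr : Irreducible (ℓ : ℤ) := hℓZ.irreducible
  have h3 : 3 ≤ ℓ := by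
    have := hℓ.two_le; omega
  rcases he with rfl | rfl
  · refine ⟨hℓZ.squarefree, by omega, by exact_mod_cast hℓ.ne_zero, dvd_rfl, fun d hd => ?_⟩
    exact (Irreducible.coprime_iff_not_dvd hirr).mpr hd
  · refine ⟨hℓZ.neg.squarefree, by omega, by simpa using hℓ.ne_zero, (dvd_neg).mpr dvd_rfl,
      fun d hd => ?_⟩
    exact ((Irreducible.coprime_iff_not_dvd hirr).mpr hd).neg_left

/-! ## §2 Multiplying and peeling a prime discriminant -/

/-- **`ℓ* · d` is a fundamental discriminant** for `d` a fundamental discriminant or `1` and `ℓ` an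
odd prime not dividing `d` (`ℓ* ≡ 1 (mod 4)` keeps the residues; coprime factors keep
square-freeness). [cite: Cox2013, §3.B Thm. 3.15 (shape)] -/
theorem isFundamental_primeDiscr_mul {ℓ : ℕ} (hℓ : ℓ.Prime) (h2 : ℓ ≠ 2) {e : ℤ} (he4 : e % 4 = 1)
    (he : e = ℓ ∨ e = -ℓ) {d : ℤ}
    (hd : ((d % 4 = 1 ∧ Squarefree d ∧ d ≠ 1) ∨
      (4 ∣ d ∧ (d / 4 % 4 = 2 ∨ d / 4 % 4 = 3) ∧ Squarefree (d / 4))) ∨ d = 1)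
    (hnd : ¬ (ℓ : ℤ) ∣ d) :
    ((e * d) % 4 = 1 ∧ Squarefree (e * d) ∧ e * d ≠ 1) ∨
      (4 ∣ e * d ∧ (e * d / 4 % 4 = 2 ∨ e * d / 4 % 4 = 3) ∧ Squarefree (e * d / 4)) := by
  obtain ⟨hesq, he1, he0, -, hcop⟩ := primeDiscr_props hℓ h2 he
  rcases hd with (⟨hd4, hdsq, hd1⟩ | ⟨h4d, hdm, hdsq⟩) | rfl
  · -- `d ≡ 1 (mod 4)` squarefree
    refine Or.inl ⟨by rw [mul_emod_four_of_emod_four_eq_one he4, hd4],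
      squarefree_mul_iff.mpr ⟨(hcop d hnd).isRelPrime, hesq, hdsq⟩, fun h => ?_⟩
    have hdvd : d ∣ 1 := ⟨e, by rw [mul_comm]; exact h.symm⟩
    rcases Int.isUnit_iff.mp (isUnit_of_dvd_one hdvd) with h1 | h1
    · exact hd1 h1
    · rw [h1] at hd4; norm_num at hd4
  · -- `d = 4m`, `m ≡ 2, 3 (mod 4)` squarefree
    obtain ⟨m, rfl⟩ := h4d
    rw [Int.mul_ediv_cancel_left _ four_ne_zero] at hdm hdsq
    have hnm : ¬ (ℓ : ℤ) ∣ m := fun h => hnd (h.mul_left 4)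
    have hediv : e * (4 * m) / 4 = e * m := by
      rw [show e * (4 * m) = 4 * (e * m) by ring, Int.mul_ediv_cancel_left _ four_ne_zero]
    refine Or.inr ⟨⟨e * m, by ring⟩, ?_, ?_⟩
    · rw [hediv, mul_emod_four_of_emod_four_eq_one he4]; exact hdm
    · rw [hediv]; exact squarefree_mul_iff.mpr ⟨(hcop m hnm).isRelPrime, hesq, hdsq⟩
  · -- `d = 1`
    rw [mul_one]
    exact Or.inl ⟨he4, hesq, he1⟩

/-- **Peeling a prime discriminant off a fundamental discriminant.** For `D` fundamental and an odd
prime `ℓ ∣ D`: `D = ℓ* · (D/ℓ*)` with `D/ℓ*` fundamental or `1`, and `ℓ ∤ D/ℓ*` (no odd square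
divides a fundamental discriminant). [cite: Cox2013, §3.B Thm. 3.15 (shape)] -/
theorem isFundamental_or_eq_one_div_primeDiscr {ℓ : ℕ} (hℓ : ℓ.Prime) (h2 : ℓ ≠ 2) {e : ℤ}
    (he4 : e % 4 = 1) (he : e = ℓ ∨ e = -ℓ) {D : ℤ}
    (hD : (D % 4 = 1 ∧ Squarefree D ∧ D ≠ 1) ∨
      (4 ∣ D ∧ (D / 4 % 4 = 2 ∨ D / 4 % 4 = 3) ∧ Squarefree (D / 4)))
    (hℓD : (ℓ : ℤ) ∣ D) :
    ((((D / e) % 4 = 1 ∧ Squarefree (D / e) ∧ D / e ≠ 1) ∨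
        (4 ∣ D / e ∧ (D / e / 4 % 4 = 2 ∨ D / e / 4 % 4 = 3) ∧ Squarefree (D / e / 4))) ∨
          D / e = 1) ∧
      D = e * (D / e) ∧ ¬ (ℓ : ℤ) ∣ D / e := by
  have hℓZ : Prime (ℓ : ℤ) := Nat.prime_iff_prime_int.mp hℓ
  obtain ⟨-, -, he0, hℓe, -⟩ := primeDiscr_props hℓ h2 he
  have heD : e ∣ D := by
    rcases he with rfl | rfl
    · exact hℓD
    · exact (neg_dvd).mpr hℓD
  have hDe : D = e * (D / e) := (Int.mul_ediv_cancel' heD).symm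
  -- no odd square divides `D`: `ℓ ∤ D/ℓ*`
  have hnsq : ¬ (ℓ : ℤ) ∣ D / e := by
    intro h
    have h2D : (ℓ : ℤ) * ℓ ∣ D := by rw [hDe]; exact mul_dvd_mul hℓe h
    rcases hD with ⟨-, hsq, -⟩ | ⟨h4, -, hsq⟩
    · exact hℓZ.not_unit (hsq _ h2D)
    · obtain ⟨m, rfl⟩ := h4
      rw [Int.mul_ediv_cancel_left _ four_ne_zero] at hsq
      have hcop4 : IsCoprime ((ℓ : ℤ) * ℓ) 4 := by
        have h1 : IsCoprime (ℓ : ℤ) 2 := by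
          refine (Irreducible.coprime_iff_not_dvd hℓZ.irreducible).mpr fun h => h2 ?_
          have := Int.le_of_dvd two_pos h
          have h2le := hℓ.two_le
          have : (ℓ : ℤ) ∣ 2 := h
          exact le_antisymm (by exact_mod_cast Int.le_of_dvd two_pos this) h2le
        have h4' : IsCoprime (ℓ : ℤ) 4 := by
          rw [show (4 : ℤ) = 2 * 2 by norm_num]; exact h1.mul_right h1
        exact h4'.mul_left h4'
      exact hℓZ.not_unit (hsq _ (hcop4.dvd_of_dvd_mul_left h2D))
  refine ⟨?_, hDe, hnsq⟩
  rcases hD with ⟨hD4, hDsq, -⟩ | ⟨h4, hDm, hDsq⟩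
  · -- `D ≡ 1 (mod 4)`: `D/ℓ* ≡ 1 (mod 4)` squarefree, possibly `1`
    have hm4 : D / e % 4 = 1 := by
      have := mul_emod_four_of_emod_four_eq_one he4 (D / e)
      rw [← hDe, hD4] at this
      exact this.symm
    have hmsq : Squarefree (D / e) := hDsq.squarefree_of_dvd ⟨e, by rw [mul_comm]; exact hDe⟩
    by_cases h1 : D / e = 1
    · exact Or.inr h1
    · exact Or.inl (Or.inl ⟨hm4, hmsq, h1⟩)
  · -- `D = 4k`: `ℓ ∣ k`, `D/ℓ* = 4 (k/ℓ*)`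
    obtain ⟨k, rfl⟩ := h4
    rw [Int.mul_ediv_cancel_left _ four_ne_zero] at hDm hDsq
    have hℓk : (ℓ : ℤ) ∣ k := by
      have hcop : IsCoprime (ℓ : ℤ) 4 := by
        have h1 : IsCoprime (ℓ : ℤ) 2 := by
          refine (Irreducible.coprime_iff_not_dvd hℓZ.irreducible).mpr fun h => h2 ?_
          exact le_antisymm (by exact_mod_cast Int.le_of_dvd two_pos h) hℓ.two_le
        rw [show (4 : ℤ) = 2 * 2 by norm_num]; exact h1.mul_right h1
      exact hcop.dvd_of_dvd_mul_left hℓD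
    have hek : e ∣ k := by
      rcases he with rfl | rfl
      · exact hℓk
      · exact (neg_dvd).mpr hℓk
    have hk : k = e * (k / e) := (Int.mul_ediv_cancel' hek).symm
    have hquot : 4 * k / e = 4 * (k / e) := by
      conv_lhs => rw [hk, show 4 * (e * (k / e)) = e * (4 * (k / e)) by ring]
      rw [Int.mul_ediv_cancel_left _ he0]
    rw [hquot, Int.mul_ediv_cancel_left _ four_ne_zero]
    refine Or.inl (Or.inr ⟨⟨k / e, rfl⟩, ?_, hDsq.squarefree_of_dvd ⟨e, by rw [mul_comm]; exact hk⟩⟩)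
    have := mul_emod_four_of_emod_four_eq_one he4 (k / e)
    rw [← hk] at this
    rw [← this]; exact hDm

/-! ## §3 The genus split along a prescribed set of primes -/

/-- **Genus split of a fundamental discriminant.** For `D` a fundamental discriminant or `1` and any
predicate `P` on primes: `D = d₁ · d₂` with `d₁`, `d₂` fundamental discriminants or `1`, every odd
prime `ℓ ∣ D` dividing `d₁` when `P ℓ` and `d₂` otherwise, and the dyadic part of `D` on the side of
`P 2` (so `d₂ ≡ 1 (mod 4)` if `P 2`, `d₁ ≡ 1 (mod 4)` if `¬ P 2`). Proof: induction on `|D|`, peeling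
one odd prime discriminant at a time (`isFundamental_or_eq_one_div_primeDiscr`,
`isFundamental_primeDiscr_mul`); when no odd prime divides `D`, `D ∈ {1, −4, ±8}` goes wholesale to
one side. [cite: Cox2013, §3.B Thm. 3.15 (D = ∏ pᵢ*)] -/
theorem exists_genusSplit (P : ℕ → Prop) (D : ℤ)
    (hD : ((D % 4 = 1 ∧ Squarefree D ∧ D ≠ 1) ∨
      (4 ∣ D ∧ (D / 4 % 4 = 2 ∨ D / 4 % 4 = 3) ∧ Squarefree (D / 4))) ∨ D = 1) :
    ∃ d₁ d₂ : ℤ,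
      (((d₁ % 4 = 1 ∧ Squarefree d₁ ∧ d₁ ≠ 1) ∨
        (4 ∣ d₁ ∧ (d₁ / 4 % 4 = 2 ∨ d₁ / 4 % 4 = 3) ∧ Squarefree (d₁ / 4))) ∨ d₁ = 1) ∧
      (((d₂ % 4 = 1 ∧ Squarefree d₂ ∧ d₂ ≠ 1) ∨
        (4 ∣ d₂ ∧ (d₂ / 4 % 4 = 2 ∨ d₂ / 4 % 4 = 3) ∧ Squarefree (d₂ / 4))) ∨ d₂ = 1) ∧
      d₁ * d₂ = D ∧
      (∀ ℓ : ℕ, ℓ.Prime → ℓ ≠ 2 → (ℓ : ℤ) ∣ D →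
        (P ℓ → (ℓ : ℤ) ∣ d₁) ∧ (¬ P ℓ → (ℓ : ℤ) ∣ d₂)) ∧
      (P 2 → d₂ % 4 = 1) ∧ (¬ P 2 → d₁ % 4 = 1) := by
  classical
  -- strong induction on `|D|`
  suffices h : ∀ (n : ℕ) (D : ℤ), D.natAbs = n →
      (((D % 4 = 1 ∧ Squarefree D ∧ D ≠ 1) ∨
        (4 ∣ D ∧ (D / 4 % 4 = 2 ∨ D / 4 % 4 = 3) ∧ Squarefree (D / 4))) ∨ D = 1) →
      ∃ d₁ d₂ : ℤ,
        (((d₁ % 4 = 1 ∧ Squarefree d₁ ∧ d₁ ≠ 1) ∨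
          (4 ∣ d₁ ∧ (d₁ / 4 % 4 = 2 ∨ d₁ / 4 % 4 = 3) ∧ Squarefree (d₁ / 4))) ∨ d₁ = 1) ∧
        (((d₂ % 4 = 1 ∧ Squarefree d₂ ∧ d₂ ≠ 1) ∨
          (4 ∣ d₂ ∧ (d₂ / 4 % 4 = 2 ∨ d₂ / 4 % 4 = 3) ∧ Squarefree (d₂ / 4))) ∨ d₂ = 1) ∧
        d₁ * d₂ = D ∧
        (∀ ℓ : ℕ, ℓ.Prime → ℓ ≠ 2 → (ℓ : ℤ) ∣ D →
          (P ℓ → (ℓ : ℤ) ∣ d₁) ∧ (¬ P ℓ → (ℓ : ℤ) ∣ d₂)) ∧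
        (P 2 → d₂ % 4 = 1) ∧ (¬ P 2 → d₁ % 4 = 1) from h _ D rfl hD
  intro n
  induction n using Nat.strong_induction_on with
  | _ n ih =>
  intro D hn hD
  by_cases hex : ∃ ℓ : ℕ, ℓ.Prime ∧ ℓ ≠ 2 ∧ (ℓ : ℤ) ∣ D
  · -- peel one odd prime discriminant
    obtain ⟨ℓ, hℓ, h2, hℓD⟩ := hex
    obtain ⟨e, he4, he⟩ := exists_primeDiscr hℓ h2
    have hD' : (D % 4 = 1 ∧ Squarefree D ∧ D ≠ 1) ∨
        (4 ∣ D ∧ (D / 4 % 4 = 2 ∨ D / 4 % 4 = 3) ∧ Squarefree (D / 4)) := by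
      rcases hD with h | rfl
      · exact h
      · exfalso
        have := Int.le_of_dvd one_pos hℓD
        have h2le := hℓ.two_le
        omega
    obtain ⟨hshape, hDe, hnd⟩ := isFundamental_or_eq_one_div_primeDiscr hℓ h2 he4 he hD' hℓD
    obtain ⟨-, -, he0, hℓe, -⟩ := primeDiscr_props hℓ h2 he
    -- `|D / ℓ*| < |D|`
    have hlt : (D / e).natAbs < n := by
      rw [← hn]
      conv_rhs => rw [hDe]
      rw [Int.natAbs_mul]
      have he3 : 3 ≤ e.natAbs := by
        have := hℓ.two_le
        rcases he with rfl | rfl <;> simp <;> omega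
      have hq0 : (D / e).natAbs ≠ 0 := by
        intro h0
        rw [Int.natAbs_eq_zero] at h0
        rw [h0, mul_zero] at hDe
        rcases hD' with ⟨h1, -, -⟩ | ⟨-, hm, -⟩
        · rw [hDe] at h1; norm_num at h1
        · rw [hDe] at hm; norm_num at hm
      nlinarith [Nat.pos_of_ne_zero hq0]
    obtain ⟨a₁, a₂, ha₁, ha₂, hprod, hodd, h2P, h2nP⟩ := ih _ hlt (D / e) rfl hshape
    -- `ℓ` divides neither `a₁` nor `a₂`
    have hna₁ : ¬ (ℓ : ℤ) ∣ a₁ := fun h => hnd (hprod ▸ h.mul_right a₂)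
    have hna₂ : ¬ (ℓ : ℤ) ∣ a₂ := fun h => hnd (hprod ▸ h.mul_left a₁)
    by_cases hP : P ℓ
    · -- attach `ℓ*` to `d₁`
      refine ⟨e * a₁, a₂, Or.inl (isFundamental_primeDiscr_mul hℓ h2 he4 he ha₁ hna₁), ha₂,
        by rw [mul_assoc, hprod, ← hDe], fun q hq hq2 hqD => ⟨fun _ => ?_, fun hnq => ?_⟩, h2P,
        fun h => by rw [mul_emod_four_of_emod_four_eq_one he4]; exact h2nP h⟩
      · by_cases hqℓ : q = ℓ
        · subst hqℓ; exact hℓe.mul_right a₁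
        · have hqD' : (q : ℤ) ∣ D / e := by
            have hqZ : Prime (q : ℤ) := Nat.prime_iff_prime_int.mp hq
            rw [hDe] at hqD
            rcases hqZ.dvd_or_dvd hqD with h | h
            · exfalso
              have : (q : ℤ) ∣ (ℓ : ℤ) := by
                rcases he with rfl | rfl
                · exact h
                · exact (dvd_neg).mp h
              have := (Nat.prime_dvd_prime_iff_eq hq hℓ).mp (by exact_mod_cast this)
              exact hqℓ this
            · exact h
          exact ((hodd q hq hq2 hqD').1 ‹P q›).mul_left e
      · by_cases hqℓ : q = ℓ
        · subst hqℓ; exact absurd hP hnq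
        · have hqD' : (q : ℤ) ∣ D / e := by
            have hqZ : Prime (q : ℤ) := Nat.prime_iff_prime_int.mp hq
            rw [hDe] at hqD
            rcases hqZ.dvd_or_dvd hqD with h | h
            · exfalso
              have : (q : ℤ) ∣ (ℓ : ℤ) := by
                rcases he with rfl | rfl
                · exact h
                · exact (dvd_neg).mp h
              have := (Nat.prime_dvd_prime_iff_eq hq hℓ).mp (by exact_mod_cast this)
              exact hqℓ this
            · exact h
          exact (hodd q hq hq2 hqD').2 hnq
    · -- attach `ℓ*` to `d₂`
      refine ⟨a₁, e * a₂, ha₁, Or.inl (isFundamental_primeDiscr_mul hℓ h2 he4 he ha₂ hna₂),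
        by rw [mul_left_comm, hprod, ← hDe], fun q hq hq2 hqD => ⟨fun hPq => ?_, fun _ => ?_⟩,
        fun h => by rw [mul_emod_four_of_emod_four_eq_one he4]; exact h2P h, h2nP⟩
      · by_cases hqℓ : q = ℓ
        · subst hqℓ; exact absurd hPq hP
        · have hqD' : (q : ℤ) ∣ D / e := by
            have hqZ : Prime (q : ℤ) := Nat.prime_iff_prime_int.mp hq
            rw [hDe] at hqD
            rcases hqZ.dvd_or_dvd hqD with h | h
            · exfalso
              have : (q : ℤ) ∣ (ℓ : ℤ) := by
                rcases he with rfl | rfl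
                · exact h
                · exact (dvd_neg).mp h
              have := (Nat.prime_dvd_prime_iff_eq hq hℓ).mp (by exact_mod_cast this)
              exact hqℓ this
            · exact h
          exact (hodd q hq hq2 hqD').1 hPq
      · by_cases hqℓ : q = ℓ
        · subst hqℓ; exact hℓe.mul_right a₂
        · have hqD' : (q : ℤ) ∣ D / e := by
            have hqZ : Prime (q : ℤ) := Nat.prime_iff_prime_int.mp hq
            rw [hDe] at hqD
            rcases hqZ.dvd_or_dvd hqD with h | h
            · exfalso
              have : (q : ℤ) ∣ (ℓ : ℤ) := by
                rcases he with rfl | rfl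
                · exact h
                · exact (dvd_neg).mp h
              have := (Nat.prime_dvd_prime_iff_eq hq hℓ).mp (by exact_mod_cast this)
              exact hqℓ this
            · exact h
          exact ((hodd q hq hq2 hqD').2 ‹¬ P q›).mul_left e
  · -- no odd prime divides `D`: `D ∈ {1, -4, 8, -8}` goes to one side
    push Not at hex
    have hvac : ∀ ℓ : ℕ, ℓ.Prime → ℓ ≠ 2 → (ℓ : ℤ) ∣ D → False := fun ℓ hℓ h2 h => hex ℓ hℓ h2 h
    by_cases hP2 : P 2
    · refine ⟨D, 1, hD, Or.inr rfl, mul_one D, fun ℓ hℓ h2 h => (hvac ℓ hℓ h2 h).elim,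
        fun _ => by norm_num, fun h => absurd hP2 h⟩
    · refine ⟨1, D, Or.inr rfl, hD, one_mul D, fun ℓ hℓ h2 h => (hvac ℓ hℓ h2 h).elim,
        fun h => absurd h hP2, fun _ => by norm_num⟩

end Summit.BirchSwinnertonDyer.BirchSwinnertonDyer.Theorems.GenusGrossZagier
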